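/-
Copyright: the b2b-balaban T⁴-continuum CRUX team, row NE7b OWNER lineage `t4-ne7b-p1` (gen 122). Project licence.
-/
import Summits.QuantumFields.BalabanUV.T4Continuum.Spine.NE7b.SupTorusPerturbedSupNorm
import Summits.QuantumFields.BalabanUV.T4Continuum.Spine.NE7b.SupTorusGradientRoad

/-!
# THE PERTURBED PROPAGATOR `(H_V + K)⁻¹` ON `ℓ^∞`: LIPSCHITZ IN THE POTENTIAL, LIPSCHITZ IN THE KERNEL, AND ITS GRADIENT IS BOUNDED —
# MESH- AND VOLUME-FREE, `d ≥ 3` ((157) §4 and (156) `gradient_bound_road` RE-RUN for `H + K`; row NE7b, node U5c; (156)∕(165)∕(170) BY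
# NAME; [folklore])

Cell `pub-balaban`, sub-cell `t4`, spine estimate NE7b (`T4WeightBudget.RelWeightBound`; the cell's OWN estimate — NOT PRINTED in
[Bałaban 1983–89], NOT PROVED).  Crux-route work under `Spine/NE7b/` by the row OWNER (`t4-ne7b-p1` gen 122, file (171)) under FREEZE
(0)'s crux-prover clause; NOTHING of Bałaban's is named as a Lean object, valued or asserted; no `T4Continuum/Support` leaf typed; no `def`,
no notation; zero `sorry`.  Imports (BY NAME): the OWNER's (170) `…SupTorusPerturbedSupNorm` (`perturbed_supNorm_bound`; through it (165)
`perturbed_action_sub`, (163) `rowsum_le`), (156) `…SupTorusGradientRoad` (`gradient_bound_road`).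

WHY (located).  The regularity of the locality column in the background ((141)–(143), (157) §4) is what the road's smoothness statements
consume; for the perturbed Hessian the same two identities do the work: `(H_{V₁} + K₁)(u₁ − u₂) = −(V₁ − V₂)u₂ − (K₁ − K₂)u₂` when
`(H_{V_i} + K_i)u_i = f` (§1), and (170)'s `ℓ^∞` bound twice.  The gradient bound is (156) applied to `Hu = f − Ku`.

WHAT IS PROVED ([folklore]; fine torus `Site d ((n+1)s)`; `(H_V + K)u` DISPLAYED; `K_α = (2∕(1 − e^{−α}))^d`):
* §1 `perturbed_action_sub_two` (the difference identity for two potentials and two kernels).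
* §2 **`perturbed_supNorm_lipschitz_potential`** (`d ≥ 3`, `a > 0`, `λ < min(2,a)`, `Λ ≥ 0`, `γ > 0`): `∃ ε₀, C > 0`, for ALL `n, s`,
  `V₁, V₂ ∈ [−λ, Λ]` with `|V₁ − V₂| ≤ D`, kernels `|K| ≤ ε₀e^{−γρ_N}`, `|f| ≤ M`, `(H_{V_i} + K)u_i = f`: `|u₁ x − u₂ x| ≤ C·D·M`.
* §3 **`perturbed_supNorm_lipschitz_kernel`**: the same with ONE potential and TWO kernels `|K_i| ≤ ε₀e^{−γρ_N}`, `|K₁ − K₂| ≤ ηe^{−γρ_N}`: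
  `|u₁ x − u₂ x| ≤ C·η·M`.
* §4 **`perturbed_gradient_bound`** (`d ≥ 3`): `∃ ε₀, C > 0`, for ALL `n, s`, `−λ ≤ V ≤ Λ`, `|K| ≤ ε₀e^{−γρ_N}`, `|f| ≤ M`, `(H + K)u = f`:
  `(n+1)|u(x + ê_μ) − u x| ≤ C·M`.
* §5 toy.

HONEST (what this is NOT).  `ℓ^∞` letters only; the pointwise exponential DECAY of `(H + K)⁻¹` and the volume comparison for `H + K`
remain re-runs of (153)–(161); cubic periods; scalar skeleton ((A3), NC-NE7b-α UNRULED); nothing of Bałaban's.  BY-NAME EFFECT ON THE WALL: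
NONE.  NE7b NOT PRINTED ∕ NOT PROVED; spine PROVED 0∕9; rung (B)+1 on a FINITE torus — NOT infinite volume, NOT the mass gap, NOT Clay.
HONEST DEPENDENCY: continuum YM on T⁴ ⇐ BetaPertH ∧ nine spine estimates (0∕9 proved); BetaPertH ⇐ (D1) ∧ (D4) ∧ CAP+tail; G-an2-4
gates asym, D1 and NE2∕3∕4.
-/

set_option autoImplicit false

noncomputable section

namespace Summit.QuantumFields.BalabanUV.T4Continuum.NE7b.SupTorusPerturbedSupNormLipschitz

open Real
open Literature.MathematicalPhysics.QuantumFieldTheory.Balaban1983to89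
open B6QGQLower276 (X e blk B side chart mem_B sum_B sum_B_const card_cube blk_chart)
open Beta (Site siteOf windowMap siteOf_windowMap siteOf_add)
open SupTorusGradientRoad (gradient_bound_road)
open SupTorusPerturbedKernelSums (rowsum_le)
open SupTorusPerturbedColumns (perturbed_action_sub)
open SupTorusPerturbedSupNorm (perturbed_supNorm_bound)

variable {d : ℕ}

/-! ## §1. The difference identity for two potentials and two kernels -/

/-- **`(H_{V₁} + K₁)(u₁ − u₂) = −(V₁ − V₂)u₂ − (K₁ − K₂)u₂`** when `(H_{V₁} + K₁)u₁ = f = (H_{V₂} + K₂)u₂` ((165) `perturbed_action_sub`). [folklore] -/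
theorem perturbed_action_sub_two (n : ℕ) (a : ℝ) (s : ℕ) [NeZero s] (V₁ V₂ : Site d ((n + 1) * s) → ℝ)
    (K₁ K₂ : Site d ((n + 1) * s) → Site d ((n + 1) * s) → ℝ) (u₁ u₂ f : Site d ((n + 1) * s) → ℝ)
    (hu₁ : ∀ x, ((n : ℝ) + 1) ^ 2 * ∑ μ, (2 * u₁ x - u₁ (x + siteOf d ((n + 1) * s) (e μ)) - u₁ (x - siteOf d ((n + 1) * s) (e μ)))
      + a / ((n : ℝ) + 1) ^ d * ∑ q ∈ B n (blk n (windowMap d ((n + 1) * s) x)), u₁ (siteOf d ((n + 1) * s) q) + V₁ x * u₁ x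
      + ∑ z, K₁ x z * u₁ z = f x)
    (hu₂ : ∀ x, ((n : ℝ) + 1) ^ 2 * ∑ μ, (2 * u₂ x - u₂ (x + siteOf d ((n + 1) * s) (e μ)) - u₂ (x - siteOf d ((n + 1) * s) (e μ)))
      + a / ((n : ℝ) + 1) ^ d * ∑ q ∈ B n (blk n (windowMap d ((n + 1) * s) x)), u₂ (siteOf d ((n + 1) * s) q) + V₂ x * u₂ x
      + ∑ z, K₂ x z * u₂ z = f x) (x : Site d ((n + 1) * s)) :
    ((n : ℝ) + 1) ^ 2 * ∑ μ, (2 * (u₁ x - u₂ x) - (u₁ (x + siteOf d ((n + 1) * s) (e μ)) - u₂ (x + siteOf d ((n + 1) * s) (e μ)))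
          - (u₁ (x - siteOf d ((n + 1) * s) (e μ)) - u₂ (x - siteOf d ((n + 1) * s) (e μ))))
        + a / ((n : ℝ) + 1) ^ d * ∑ q ∈ B n (blk n (windowMap d ((n + 1) * s) x)), (u₁ (siteOf d ((n + 1) * s) q) - u₂ (siteOf d ((n + 1) * s) q))
        + V₁ x * (u₁ x - u₂ x) + ∑ z, K₁ x z * (u₁ z - u₂ z)
      = -((V₁ x - V₂ x) * u₂ x) - ∑ z, (K₁ x z - K₂ x z) * u₂ z := by
  rw [perturbed_action_sub n a s V₁ K₁ u₁ u₂ x, hu₁ x]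
  have h2 := hu₂ x
  have hK : ∑ z, (K₁ x z - K₂ x z) * u₂ z = ∑ z, K₁ x z * u₂ z - ∑ z, K₂ x z * u₂ z := by
    simp only [sub_mul, Finset.sum_sub_distrib]
  rw [hK]
  linarith

/-! ## §2. `(H_V + K)⁻¹` is Lipschitz in the potential on `ℓ^∞` -/

/-- **`‖(H_{V₁} + K)⁻¹f − (H_{V₂} + K)⁻¹f‖_∞ ≤ C·‖V₁ − V₂‖_∞·‖f‖_∞`, `d ≥ 3`, every mesh, every volume, every source**: THERE ARE `ε₀, C > 0`
such that for ALL `n, s`, `V₁, V₂ ∈ [−λ, Λ]` with `|V₁ − V₂| ≤ D`, ALL kernels `|K| ≤ ε₀e^{−γρ_N}`, `(H_{V₁} + K)u₁ = f = (H_{V₂} + K)u₂`,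
`|f| ≤ M`: `|u₁ x − u₂ x| ≤ C·D·M` — §1 (`(H_{V₁} + K)(u₁ − u₂) = −(V₁ − V₂)u₂`) and (170) twice. [folklore] -/
theorem perturbed_supNorm_lipschitz_potential (hd : 3 ≤ d) (a : ℝ) (ha : 0 < a) {lam Lam γ : ℝ} (hlam : lam < min 2 a) (hLam : 0 ≤ Lam)
    (hγ : 0 < γ) :
    ∃ ε₀ C : ℝ, 0 < ε₀ ∧ 0 < C ∧ ∀ (n s : ℕ) [NeZero s] (V₁ V₂ : Site d ((n + 1) * s) → ℝ), (∀ x, -lam ≤ V₁ x) → (∀ x, V₁ x ≤ Lam) →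
      (∀ x, -lam ≤ V₂ x) → (∀ x, V₂ x ≤ Lam) → ∀ D : ℝ, (∀ x, |V₁ x - V₂ x| ≤ D) →
      ∀ K : Site d ((n + 1) * s) → Site d ((n + 1) * s) → ℝ,
      (∀ x z, |K x z| ≤ ε₀ * exp (-(γ * ∑ i, (((x i - z i).valMinAbs.natAbs : ℕ) : ℝ)))) →
      ∀ (M : ℝ) (u₁ u₂ f : Site d ((n + 1) * s) → ℝ), (∀ x, |f x| ≤ M) →
      (∀ x, ((n : ℝ) + 1) ^ 2 * ∑ μ, (2 * u₁ x - u₁ (x + siteOf d ((n + 1) * s) (e μ)) - u₁ (x - siteOf d ((n + 1) * s) (e μ)))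
        + a / ((n : ℝ) + 1) ^ d * ∑ q ∈ B n (blk n (windowMap d ((n + 1) * s) x)), u₁ (siteOf d ((n + 1) * s) q) + V₁ x * u₁ x
        + ∑ z, K x z * u₁ z = f x) →
      (∀ x, ((n : ℝ) + 1) ^ 2 * ∑ μ, (2 * u₂ x - u₂ (x + siteOf d ((n + 1) * s) (e μ)) - u₂ (x - siteOf d ((n + 1) * s) (e μ)))
        + a / ((n : ℝ) + 1) ^ d * ∑ q ∈ B n (blk n (windowMap d ((n + 1) * s) x)), u₂ (siteOf d ((n + 1) * s) q) + V₂ x * u₂ x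
        + ∑ z, K x z * u₂ z = f x) →
      ∀ x : Site d ((n + 1) * s), |u₁ x - u₂ x| ≤ C * D * M := by
  classical
  obtain ⟨ε₀, C₀, hε₀, hC₀, H0⟩ := perturbed_supNorm_bound (d := d) hd a ha hlam hLam hγ
  refine ⟨ε₀, C₀ * C₀, hε₀, by positivity, ?_⟩
  intro n s _ V₁ V₂ hV₁ hV₁' hV₂ hV₂' D hD K hK M u₁ u₂ f hfM hu₁ hu₂ x
  have hM : 0 ≤ M := (abs_nonneg _).trans (hfM x)
  have hD0 : 0 ≤ D := (abs_nonneg _).trans (hD x)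
  -- `‖u₂‖_∞ ≤ C₀M`
  have hu₂sup : ∀ x', |u₂ x'| ≤ C₀ * M := fun x' => H0 n s V₂ hV₂ hV₂' K hK M u₂ f hfM hu₂ x'
  -- `(H_{V₁} + K)(u₁ − u₂) = −(V₁ − V₂)u₂`, a source of size `D·C₀M`
  have hw := perturbed_action_sub_two n a s V₁ V₂ K K u₁ u₂ f hu₁ hu₂
  have hsrc : ∀ x', |-((V₁ x' - V₂ x') * u₂ x') - ∑ z, (K x' z - K x' z) * u₂ z| ≤ D * (C₀ * M) := fun x' => by
    simp only [sub_self, zero_mul, Finset.sum_const_zero, sub_zero, abs_neg, abs_mul]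
    exact mul_le_mul (hD x') (hu₂sup x') (abs_nonneg _) hD0
  have h := H0 n s V₁ hV₁ hV₁' K hK (D * (C₀ * M)) (fun x' => u₁ x' - u₂ x')
    (fun x' => -((V₁ x' - V₂ x') * u₂ x') - ∑ z, (K x' z - K x' z) * u₂ z) hsrc hw x
  refine h.trans (le_of_eq ?_)
  ring

/-! ## §3. `(H + K)⁻¹` is Lipschitz in the kernel on `ℓ^∞` -/

/-- **`‖(H + K₁)⁻¹f − (H + K₂)⁻¹f‖_∞ ≤ C·η·‖f‖_∞` FOR `|K₁ − K₂| ≤ ηe^{−γρ_N}`, `d ≥ 3`, every mesh, every volume, every source**: THERE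
ARE `ε₀, C > 0` such that for ALL `n, s`, `−λ ≤ V ≤ Λ`, kernels `|K_i| ≤ ε₀e^{−γρ_N}` with `|K₁ − K₂| ≤ ηe^{−γρ_N}` (`η ≥ 0`),
`(H + K_i)u_i = f`, `|f| ≤ M`: `|u₁ x − u₂ x| ≤ C·η·M` — §1 (`(H + K₁)(u₁ − u₂) = −(K₁ − K₂)u₂`), (163) `rowsum_le`, (170) twice. [folklore] -/
theorem perturbed_supNorm_lipschitz_kernel (hd : 3 ≤ d) (a : ℝ) (ha : 0 < a) {lam Lam γ : ℝ} (hlam : lam < min 2 a) (hLam : 0 ≤ Lam)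
    (hγ : 0 < γ) :
    ∃ ε₀ C : ℝ, 0 < ε₀ ∧ 0 < C ∧ ∀ (n s : ℕ) [NeZero s] (V : Site d ((n + 1) * s) → ℝ), (∀ x, -lam ≤ V x) → (∀ x, V x ≤ Lam) →
      ∀ K₁ K₂ : Site d ((n + 1) * s) → Site d ((n + 1) * s) → ℝ,
      (∀ x z, |K₁ x z| ≤ ε₀ * exp (-(γ * ∑ i, (((x i - z i).valMinAbs.natAbs : ℕ) : ℝ)))) →
      (∀ x z, |K₂ x z| ≤ ε₀ * exp (-(γ * ∑ i, (((x i - z i).valMinAbs.natAbs : ℕ) : ℝ)))) →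
      ∀ η : ℝ, 0 ≤ η → (∀ x z, |K₁ x z - K₂ x z| ≤ η * exp (-(γ * ∑ i, (((x i - z i).valMinAbs.natAbs : ℕ) : ℝ)))) →
      ∀ (M : ℝ) (u₁ u₂ f : Site d ((n + 1) * s) → ℝ), (∀ x, |f x| ≤ M) →
      (∀ x, ((n : ℝ) + 1) ^ 2 * ∑ μ, (2 * u₁ x - u₁ (x + siteOf d ((n + 1) * s) (e μ)) - u₁ (x - siteOf d ((n + 1) * s) (e μ)))
        + a / ((n : ℝ) + 1) ^ d * ∑ q ∈ B n (blk n (windowMap d ((n + 1) * s) x)), u₁ (siteOf d ((n + 1) * s) q) + V x * u₁ x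
        + ∑ z, K₁ x z * u₁ z = f x) →
      (∀ x, ((n : ℝ) + 1) ^ 2 * ∑ μ, (2 * u₂ x - u₂ (x + siteOf d ((n + 1) * s) (e μ)) - u₂ (x - siteOf d ((n + 1) * s) (e μ)))
        + a / ((n : ℝ) + 1) ^ d * ∑ q ∈ B n (blk n (windowMap d ((n + 1) * s) x)), u₂ (siteOf d ((n + 1) * s) q) + V x * u₂ x
        + ∑ z, K₂ x z * u₂ z = f x) →
      ∀ x : Site d ((n + 1) * s), |u₁ x - u₂ x| ≤ C * η * M := by
  classical
  obtain ⟨ε₀, C₀, hε₀, hC₀, H0⟩ := perturbed_supNorm_bound (d := d) hd a ha hlam hLam hγ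
  set Kγ : ℝ := (2 * (1 - exp (-γ))⁻¹) ^ d with hKγ
  have hKγ0 : 0 < Kγ := pow_pos (mul_pos two_pos (inv_pos.2 (sub_pos.2 (exp_lt_one_iff.2 (by linarith))))) d
  refine ⟨ε₀, C₀ * Kγ * C₀, hε₀, by positivity, ?_⟩
  intro n s _ V hV hV' K₁ K₂ hK₁ hK₂ η hη hK12 M u₁ u₂ f hfM hu₁ hu₂ x
  have hM : 0 ≤ M := (abs_nonneg _).trans (hfM x)
  -- `‖u₂‖_∞ ≤ C₀M`
  have hu₂sup : ∀ x', |u₂ x'| ≤ C₀ * M := fun x' => H0 n s V hV hV' K₂ hK₂ M u₂ f hfM hu₂ x'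
  have hrow : ∀ x', ∑ z, |K₁ x' z - K₂ x' z| ≤ η * Kγ := fun x' => rowsum_le ((n + 1) * s) (fun x z => K₁ x z - K₂ x z) hη hK12 hγ x'
  -- `(H + K₁)(u₁ − u₂) = −(K₁ − K₂)u₂`, a source of size `ηK_γ·C₀M`
  have hw := perturbed_action_sub_two n a s V V K₁ K₂ u₁ u₂ f hu₁ hu₂
  have hsrc : ∀ x', |-((V x' - V x') * u₂ x') - ∑ z, (K₁ x' z - K₂ x' z) * u₂ z| ≤ η * Kγ * (C₀ * M) := fun x' => by
    rw [sub_self, zero_mul, neg_zero, zero_sub, abs_neg]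
    calc |∑ z, (K₁ x' z - K₂ x' z) * u₂ z| ≤ ∑ z, |(K₁ x' z - K₂ x' z) * u₂ z| := Finset.abs_sum_le_sum_abs _ _
      _ ≤ ∑ z, |K₁ x' z - K₂ x' z| * (C₀ * M) :=
          Finset.sum_le_sum fun z _ => by rw [abs_mul]; exact mul_le_mul_of_nonneg_left (hu₂sup z) (abs_nonneg _)
      _ = (∑ z, |K₁ x' z - K₂ x' z|) * (C₀ * M) := (Finset.sum_mul _ _ _).symm
      _ ≤ η * Kγ * (C₀ * M) := mul_le_mul_of_nonneg_right (hrow x') (by positivity)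
  have h := H0 n s V hV hV' K₁ hK₁ (η * Kγ * (C₀ * M)) (fun x' => u₁ x' - u₂ x')
    (fun x' => -((V x' - V x') * u₂ x') - ∑ z, (K₁ x' z - K₂ x' z) * u₂ z) hsrc hw x
  refine h.trans (le_of_eq ?_)
  ring

/-! ## §4. The gradient of `(H + K)⁻¹f` is bounded -/

/-- **GRADIENT BOUND FOR THE PERTURBED PROPAGATOR, `d ≥ 3`, every mesh, every volume, every source**: THERE ARE `ε₀, C > 0` such that for
ALL `n, s`, `−λ ≤ V ≤ Λ`, kernels `|K| ≤ ε₀e^{−γρ_N}`, `|f| ≤ M`, `(H + K)u = f`: `(n+1)|u(x + ê_μ) − u x| ≤ C·M` — (156) `gradient_bound_road`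
for `Hu = f − Ku` with `|Ku| ≤ ε₀K_γ‖u‖_∞ ≤ ε₀K_γC₀M` ((163), (170)). [folklore] -/
theorem perturbed_gradient_bound (hd : 3 ≤ d) (a : ℝ) (ha : 0 < a) {lam Lam γ : ℝ} (hlam : lam < min 2 a) (hLam : 0 ≤ Lam) (hγ : 0 < γ) :
    ∃ ε₀ C : ℝ, 0 < ε₀ ∧ 0 < C ∧ ∀ (n s : ℕ) [NeZero s] (V : Site d ((n + 1) * s) → ℝ), (∀ x, -lam ≤ V x) → (∀ x, V x ≤ Lam) →
      ∀ K : Site d ((n + 1) * s) → Site d ((n + 1) * s) → ℝ,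
      (∀ x z, |K x z| ≤ ε₀ * exp (-(γ * ∑ i, (((x i - z i).valMinAbs.natAbs : ℕ) : ℝ)))) →
      ∀ (M : ℝ) (u f : Site d ((n + 1) * s) → ℝ), (∀ x, |f x| ≤ M) →
      (∀ x, ((n : ℝ) + 1) ^ 2 * ∑ μ, (2 * u x - u (x + siteOf d ((n + 1) * s) (e μ)) - u (x - siteOf d ((n + 1) * s) (e μ)))
        + a / ((n : ℝ) + 1) ^ d * ∑ q ∈ B n (blk n (windowMap d ((n + 1) * s) x)), u (siteOf d ((n + 1) * s) q) + V x * u x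
        + ∑ z, K x z * u z = f x) →
      ∀ (x : Site d ((n + 1) * s)) (μ : Fin d), ((n : ℝ) + 1) * |u (x + siteOf d ((n + 1) * s) (e μ)) - u x| ≤ C * M := by
  classical
  obtain ⟨ε₀, C₀, hε₀, hC₀, H0⟩ := perturbed_supNorm_bound (d := d) hd a ha hlam hLam hγ
  obtain ⟨Cg, hCg, Hg⟩ := gradient_bound_road (d := d) hd a ha hlam hLam
  set Kγ : ℝ := (2 * (1 - exp (-γ))⁻¹) ^ d with hKγ
  have hKγ0 : 0 < Kγ := pow_pos (mul_pos two_pos (inv_pos.2 (sub_pos.2 (exp_lt_one_iff.2 (by linarith))))) d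
  refine ⟨ε₀, Cg * (1 + ε₀ * Kγ * C₀), hε₀, by positivity, ?_⟩
  intro n s _ V hV hV' K hK M u f hfM hu x μ
  have hM : 0 ≤ M := (abs_nonneg _).trans (hfM x)
  have husup : ∀ x', |u x'| ≤ C₀ * M := fun x' => H0 n s V hV hV' K hK M u f hfM hu x'
  have hrow : ∀ x', ∑ z, |K x' z| ≤ ε₀ * Kγ := fun x' => rowsum_le ((n + 1) * s) K hε₀.le hK hγ x'
  have hKu : ∀ x', |∑ z, K x' z * u z| ≤ ε₀ * Kγ * (C₀ * M) := fun x' =>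
    calc |∑ z, K x' z * u z| ≤ ∑ z, |K x' z * u z| := Finset.abs_sum_le_sum_abs _ _
      _ ≤ ∑ z, |K x' z| * (C₀ * M) :=
          Finset.sum_le_sum fun z _ => by rw [abs_mul]; exact mul_le_mul_of_nonneg_left (husup z) (abs_nonneg _)
      _ = (∑ z, |K x' z|) * (C₀ * M) := (Finset.sum_mul _ _ _).symm
      _ ≤ _ := mul_le_mul_of_nonneg_right (hrow x') (by positivity)
  -- `Hu = f − Ku`
  have hu' : ∀ x', ((n : ℝ) + 1) ^ 2 * ∑ μ, (2 * u x' - u (x' + siteOf d ((n + 1) * s) (e μ)) - u (x' - siteOf d ((n + 1) * s) (e μ)))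
      + a / ((n : ℝ) + 1) ^ d * ∑ q ∈ B n (blk n (windowMap d ((n + 1) * s) x')), u (siteOf d ((n + 1) * s) q) + V x' * u x'
      = f x' - ∑ z, K x' z * u z := fun x' => by have := hu x'; linarith
  have hf' : ∀ x', |f x' - ∑ z, K x' z * u z| ≤ M + ε₀ * Kγ * (C₀ * M) := fun x' =>
    (abs_sub _ _).trans (add_le_add (hfM x') (hKu x'))
  have h := Hg n s V hV hV' (M + ε₀ * Kγ * (C₀ * M)) u (fun x' => f x' - ∑ z, K x' z * u z) hf' hu' x μ
  refine h.trans (le_of_eq ?_)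
  ring

/-! ## §5. Toy -/

/-- Toy (`d = 3`, `a = 1`, `λ = 0`, `Λ = 1`, `γ = 2`): the kernel size and the constant of the perturbed gradient letter exist. -/
example : ∃ ε₀ C : ℝ, 0 < ε₀ ∧ 0 < C :=
  let ⟨ε₀, C, hε₀, hC, _⟩ := perturbed_gradient_bound (d := 3) le_rfl 1 one_pos (lam := 0) (Lam := 1) (γ := 2)
    (by norm_num) zero_le_one two_pos
  ⟨ε₀, C, hε₀, hC⟩

end Summit.QuantumFields.BalabanUV.T4Continuum.NE7b.SupTorusPerturbedSupNormLipschitz
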